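import Summits.AtomisticToContinuum.HydrodynamicLimit.Theses.JParityClosure
import Summits.AtomisticToContinuum.HydrodynamicLimit.Theorems.JParityClosureOddContactSymmetryGibbsInvariance
import Summits.AtomisticToContinuum.HydrodynamicLimit.Theorems.LambertianContactSwapContactAngleEquidistributionFluxMidpoint
import Literature.Analysis.FluidPDE.TorusPairReflection
import Literature.Analysis.FluidPDE.SphereMeasureSymmetry
import Literature.MathematicalPhysics.KineticTheory.HardSphereCampbellAssembly
import Literature.MathematicalPhysics.KineticTheory.HardSphereEulerProofs
import Literature.MathematicalPhysics.KineticTheory.MetropolisOddStatistic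
import HarnessLib

/-!
# Invariance of the Gibbs-weighted outgoing contact flux under the pair reflection `J*`
# (stub `stub_fluxPairReflect`, piece P3 of line `KineticSlabSketch`, crux `JParityClosure.OddContactSymmetry`,
# stmt-AtomisticToContinuum-17722; lead `prover-line-stmt-AtomisticToContinuum-17722-c2-0`)

Support file (`--supports stmt-AtomisticToContinuum-17722`).  WHAT.  For the canonical Gibbs density `ρ_G` of
CONSTANT profiles `(a, u, θ)` of `N + 1` hard spheres of diameter `ε = hsDiameter σ N` (`0 < σ < 1/2`) on `𝕋³` and
every measurable mark `F ≥ 0`,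
`outgoingCollisionFlux ε (N+1) (ρ_G · (F ∘ J*)) = outgoingCollisionFlux ε (N+1) (ρ_G · F)`,
where inside the flux integrand the configuration is the contact configuration `contactInsert ε i j ω z` (particle
`i` at `x_j + εω`), so that `J* = pairReflect i j (ε⁻¹ sepVec x_i x_j) = pairReflect i j ω` (positions point-reflected
about `x_j`, the pair's velocities `ω`-reflected: the `N`-body inverse-collision involution of
Cercignani–Illner–Pulvirenti 1994 §3.1 / §4.2).

HOW (the change of variables `(z, ω) ↦ (pairReflect i j ω z, −ω)` in each `(i, j)` term, `pairFlux_pairReflect`):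
* `pairReflect_contactInsert` — insertion and reflection commute up to `ω ↦ −ω`:
  `pairReflect i j ω (contactInsert ε i j ω z) = contactInsert ε i j (−ω) (pairReflect i j ω z)`; with the tree's
  invariance of the flux factor (`inner_neg_pairReflect_vel_sub`), of the hard core
  (`pairReflect_mem_hardSphereDomain_iff`) and of `ρ_G` (`canonicalDensity_pairReflect_const`: energy AND momentum
  are conserved, `configEnergy_pairReflect`, `configMomentum_pairReflect`, and the homogeneous Gibbs weight is a
  function of `∑‖v_k − u‖²`, `tensorPow_localGibbsProfile_const`), the `(F ∘ J*)`-integrand at `(z, ω)` is the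
  `F`-integrand at `(pairReflect i j ω z, −ω)`;
* `lintegral_comp_pairReflect` — for a fixed direction, `z ↦ pairReflect i j ω z` preserves the Liouville measure
  `volume` on `(𝕋^d × ℝ^d)^N`: it is the composition of the velocity reflection of the pair
  (`ContactAngleEquidistributionSketch.lintegral_comp_collidePairWith`, unit Jacobian, CIP 1994 §4.2) with the point
  reflection of all positions about `x_j` (`measurePreserving_posReflect`: on the position factor `(𝕋^d)^N` this
  is a continuous surjective endomorphism of a compact abelian group, hence Haar-measure preserving,
  `AddMonoidHom.measurePreserving`; positions and velocities are independent product coordinates);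
* `ω ↦ −ω` preserves the surface measure (`measurePreserving_neg_sphere`), and Tonelli in `(z, ω)` twice.

References: C. Cercignani, R. Illner, M. Pulvirenti, *The Mathematical Theory of Dilute Gases*, Springer (1994),
§3.1, §4.2 (the collision involution preserves Lebesgue measure, energy and `|⟨n, v − w⟩|`), App. 4.A pp. 107–111
(the measure `dσ` on the contact set `Σᵢⱼ`).
-/

noncomputable section

open scoped BigOperators Classical InnerProductSpace ENNReal Topology
open Set MeasureTheory Filter
open Literature.Analysis.FluidPDE Literature.MathematicalPhysics.KineticTheory

namespace Summit.AtomisticToContinuum.HydrodynamicLimit.Theorems.OddContactSymmetryKineticSlabSketch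

section Tools

variable {d : Type*} [Fintype d] {N : ℕ}

/-! ### The position point reflection about `x_j` preserves the Liouville measure -/

/-- **A point reflection of all coordinates about one of them preserves Haar measure on `(𝕋^d)^N`**:
`X ↦ (x_j + (x_j − x_k))_k` is a continuous surjective (indeed involutive) endomorphism of the compact abelian
group `(𝕋^d)^N`, hence measure preserving (uniqueness of Haar measure). [folklore] -/
theorem measurePreserving_posPointReflect (j : Fin N) :
    MeasurePreserving (fun X : Fin N → UnitAddTorus d => fun k => X j + (X j - X k)) volume volume := by
  haveI : BorelSpace (Fin N → UnitAddTorus d) := Pi.borelSpace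
  haveI : Measure.IsAddHaarMeasure (volume : Measure (Fin N → UnitAddTorus d)) :=
    Measure.pi.isAddHaarMeasure _
  let φ : (Fin N → UnitAddTorus d) →+ (Fin N → UnitAddTorus d) :=
    { toFun := fun X k => X j + (X j - X k)
      map_zero' := by funext k; simp
      map_add' := fun X Y => by funext k; simp only [Pi.add_apply]; abel }
  have hcont : Continuous φ :=
    continuous_pi fun k => ((continuous_apply j).add ((continuous_apply j).sub (continuous_apply k)))
  have hsurj : Function.Surjective φ := fun Y => ⟨φ Y, by
    funext k
    simp only [φ, AddMonoidHom.coe_mk, ZeroHom.coe_mk]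
    abel⟩
  exact φ.measurePreserving hcont hsurj rfl

/-- **The position point reflection about `x_j` (velocities kept) preserves the Liouville measure** `volume` on
`(𝕋^d × ℝ^d)^N` (positions and velocities are independent product coordinates; `measurePreserving_posPointReflect`
on the positions, identity on the velocities). [folklore] -/
theorem measurePreserving_posReflect (j : Fin N) :
    MeasurePreserving (fun z : Config N d (UnitAddTorus d) => fun k => ((z j).1 + ((z j).1 - (z k).1), (z k).2))
      volume volume := by
  set e := MeasurableEquiv.arrowProdEquivProdArrow (UnitAddTorus d) (EuclideanSpace ℝ d) (Fin N)
  have he : MeasurePreserving e volume volume :=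
    volume_measurePreserving_arrowProdEquivProdArrow (UnitAddTorus d) (EuclideanSpace ℝ d) (Fin N)
  have hprod := (measurePreserving_posPointReflect (d := d) j).prod
    (MeasurePreserving.id (volume : Measure (Fin N → EuclideanSpace ℝ d)))
  have htot := ((MeasurePreserving.symm e he).comp hprod).comp he
  have hfun : (fun z : Config N d (UnitAddTorus d) => fun k => ((z j).1 + ((z j).1 - (z k).1), (z k).2)) =
      e.symm ∘ (Prod.map (fun X : Fin N → UnitAddTorus d => fun k => X j + (X j - X k)) id) ∘ e := by
    funext z k
    rfl
  rw [hfun]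
  exact htot

/-! ### `pairReflect` = velocity reflection of the pair, then position point reflection -/

/-- The velocities of `pairReflect i j ω z` are those of the controlled collision of the pair across `ω`
(`collidePairWith`). [folklore] -/
theorem pairReflect_snd_eq_collidePairWith {i j : Fin N} (hij : i ≠ j) (ω : EuclideanSpace ℝ d)
    (z : Config N d (UnitAddTorus d)) (k : Fin N) : (pairReflect i j ω z k).2 = (collidePairWith i j ω z k).2 := by
  by_cases hki : k = i
  · subst hki
    rw [pairReflect_snd_left, collidePairWith_apply_left hij]
  · by_cases hkj : k = j
    · subst hkj
      rw [pairReflect_snd_right hij, collidePairWith_apply_right]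
    · rw [pairReflect_snd_other hki hkj, collidePairWith_apply_of_ne hki hkj]

/-- The total momentum is invariant under the pair reflection (`i ≠ j`; momentum conservation of the elastic
reflection, `configMomentum_collidePairWith`). [folklore] -/
theorem configMomentum_pairReflect {i j : Fin N} (hij : i ≠ j) (ω : EuclideanSpace ℝ d)
    (z : Config N d (UnitAddTorus d)) : configMomentum (pairReflect i j ω z) = configMomentum z := by
  rw [← configMomentum_collidePairWith hij ω z]
  exact Finset.sum_congr rfl fun k _ => pairReflect_snd_eq_collidePairWith hij ω z k

/-- **For a fixed direction the pair reflection preserves the Liouville measure**: `∫ f ∘ pairReflect i j ω = ∫ f`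
for measurable `f ≥ 0` — `pairReflect i j ω` is the velocity reflection of the pair (`lintegral_comp_collidePairWith`,
unit Jacobian) followed by the position point reflection about `x_j` (`measurePreserving_posReflect`).
[cite: CIP1994, §4.2] -/
theorem lintegral_comp_pairReflect {i j : Fin N} (hij : i ≠ j) (ω : EuclideanSpace ℝ d)
    {f : Config N d (UnitAddTorus d) → ℝ≥0∞} (hf : Measurable f) :
    ∫⁻ z, f (pairReflect i j ω z) = ∫⁻ z, f z := by
  set P : Config N d (UnitAddTorus d) → Config N d (UnitAddTorus d) :=
    fun z k => ((z j).1 + ((z j).1 - (z k).1), (z k).2) with hP_def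
  have hP : MeasurePreserving P volume volume := measurePreserving_posReflect (d := d) (N := N) j
  have hfun : ∀ z, pairReflect i j ω z = P (collidePairWith i j ω z) := fun z => by
    funext k
    refine Prod.ext ?_ ?_
    · simp only [hP_def, pairReflect_fst, collidePairWith_apply_fst]
    · simp only [hP_def, pairReflect_snd_eq_collidePairWith hij]
  calc ∫⁻ z, f (pairReflect i j ω z) = ∫⁻ z, (f ∘ P) (collidePairWith i j ω z) :=
        lintegral_congr fun z => by rw [hfun z]; rfl
    _ = ∫⁻ z, (f ∘ P) z :=
        ContactAngleEquidistributionSketch.lintegral_comp_collidePairWith hij ω (hf.comp hP.measurable)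
    _ = ∫⁻ z, f z := hP.lintegral_comp hf

/-- Joint measurability of `(z, ω) ↦ pairReflect i j ω z`. [folklore] -/
theorem measurable_pairReflect_uncurry (i j : Fin N) :
    Measurable fun p : Config N d (UnitAddTorus d) × EuclideanSpace ℝ d => pairReflect i j p.2 p.1 := by
  have hv : ∀ k : Fin N, Measurable fun p : Config N d (UnitAddTorus d) × EuclideanSpace ℝ d => (p.1 k).2 :=
    fun k => measurable_snd.comp ((measurable_pi_apply k).comp measurable_fst)
  have hx : ∀ k : Fin N, Measurable fun p : Config N d (UnitAddTorus d) × EuclideanSpace ℝ d => (p.1 k).1 :=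
    fun k => measurable_fst.comp ((measurable_pi_apply k).comp measurable_fst)
  have hr : Measurable fun p : Config N d (UnitAddTorus d) × EuclideanSpace ℝ d =>
      reflectVel p.2 ((p.1 i).2, (p.1 j).2) := by
    have h : Measurable fun q : EuclideanSpace ℝ d × (EuclideanSpace ℝ d × EuclideanSpace ℝ d) =>
        reflectVel q.1 q.2 := by
      unfold reflectVel
      fun_prop
    exact h.comp (measurable_snd.prodMk ((hv i).prodMk (hv j)))
  refine measurable_pi_iff.2 fun k => ?_
  refine Measurable.prodMk ((hx j).add ((hx j).sub (hx k))) ?_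
  by_cases hki : k = i
  · subst hki
    simpa only [pairReflect, if_true] using hr.fst
  · by_cases hkj : k = j
    · subst hkj
      simpa only [pairReflect, if_neg hki, if_true] using hr.snd
    · simpa only [pairReflect, if_neg hki, if_neg hkj] using hv k

/-- Joint measurability of the contact insertion in (configuration, direction), the direction ranging over the
whole space. [folklore] -/
theorem measurable_contactInsert_uncurry (ε : ℝ) (i j : Fin N) :
    Measurable fun p : Config N d (UnitAddTorus d) × EuclideanSpace ℝ d => contactInsert ε i j p.2 p.1 := by
  unfold contactInsert
  have hx : Measurable fun p : Config N d (UnitAddTorus d) × EuclideanSpace ℝ d =>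
      ((p.1 j).1 + Literature.Analysis.FunctionSpaces.Torus.proj (ε • p.2), (p.1 i).2) :=
    ((measurable_fst.comp ((measurable_pi_apply j).comp measurable_fst)).add
      ((Literature.Analysis.FunctionSpaces.Torus.measurable_proj (d := d)).comp
        ((measurable_const_smul ε).comp measurable_snd))).prodMk
      (measurable_snd.comp ((measurable_pi_apply i).comp measurable_fst))
  exact measurable_update'.comp (measurable_fst.prodMk hx)

/-- Joint measurability in (configuration, direction) — the direction ranging over the whole space — of the one-pair
outgoing flux integrand `ε^{d-1}(⟪ω, v_i − v_j⟫)₊ (1_D K)(contactInsert ε i j ω z)` of a measurable mark `K`.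
[folklore] -/
theorem measurable_fluxIntegrand_uncurry (ε : ℝ) (i j : Fin N) {K : Config N d (UnitAddTorus d) → ℝ≥0∞}
    (hK : Measurable K) :
    Measurable (Function.uncurry fun (z : Config N d (UnitAddTorus d)) (ω : EuclideanSpace ℝ d) =>
      ENNReal.ofReal (ε ^ (Fintype.card d - 1) * ⟪ω, (z i).2 - (z j).2⟫_ℝ) *
        (hardSphereDomain (Torus.geometry d) N ε).indicator K (contactInsert ε i j ω z)) := by
  have hv : ∀ k : Fin N, Measurable fun p : Config N d (UnitAddTorus d) × EuclideanSpace ℝ d => (p.1 k).2 :=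
    fun k => measurable_snd.comp ((measurable_pi_apply k).comp measurable_fst)
  have h1 : Measurable fun p : Config N d (UnitAddTorus d) × EuclideanSpace ℝ d =>
      ε ^ (Fintype.card d - 1) * ⟪p.2, (p.1 i).2 - (p.1 j).2⟫_ℝ :=
    measurable_const.mul (measurable_snd.inner ((hv i).sub (hv j)))
  have hDm : MeasurableSet (hardSphereDomain (Torus.geometry d) N ε) :=
    measurableSet_hardSphereDomain _ Torus.measurable_geometry_sepVec N ε
  exact h1.ennreal_ofReal.mul ((hK.indicator hDm).comp (measurable_contactInsert_uncurry ε i j))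

/-! ### Contact insertion and the pair reflection -/

/-- **Insertion and reflection commute up to the antipodal map**: reflecting the contact configuration
`contactInsert ε i j ω z` (particle `i` at `x_j + εω`) gives the contact configuration in the direction `−ω` of the
reflected datum (the inserted position of `i` is overwritten; its velocity is kept by the insertion). [folklore] -/
theorem pairReflect_contactInsert {i j : Fin N} (hij : i ≠ j) (ε : ℝ) (ω : EuclideanSpace ℝ d)
    (z : Config N d (UnitAddTorus d)) :
    pairReflect i j ω (contactInsert ε i j ω z) = contactInsert ε i j (-ω) (pairReflect i j ω z) := by
  funext k
  refine Prod.ext ?_ ?_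
  · rw [pairReflect_fst, contactInsert_apply_of_ne ε j ω z hij.symm]
    by_cases hki : k = i
    · subst hki
      rw [contactInsert_apply_self, contactInsert_apply_self, pairReflect_fst, sub_self, add_zero, smul_neg,
        Literature.Analysis.FunctionSpaces.Torus.proj_neg, sub_add_cancel_left]
    · rw [contactInsert_apply_of_ne ε j ω z hki, contactInsert_apply_of_ne ε j (-ω) _ hki, pairReflect_fst]
  · rw [contactInsert_vel]
    simp only [pairReflect, contactInsert_vel]

/-- **The `(F ∘ J*)`-integrand at `(z, ω)` is the `F`-integrand at `(pairReflect i j ω z, −ω)`** (`0 < ε < 1/2`,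
`i ≠ j`, unit `ω`, `ρ` invariant under `pairReflect i j ω`): inside the integrand `J* = pairReflect i j
(ε⁻¹ sepVec x_i x_j) = pairReflect i j ω` (`sepVec_contactInsert`); then `pairReflect_contactInsert`,
`inner_neg_pairReflect_vel_sub` and `pairReflect_mem_hardSphereDomain_iff`. [folklore] -/
theorem fluxIntegrand_comp_pairReflect {ε : ℝ} (hε0 : 0 < ε) (hε : ε < 1 / 2) {i j : Fin N} (hij : i ≠ j)
    {ρ F : Config N d (UnitAddTorus d) → ℝ≥0∞} (ω : Metric.sphere (0 : EuclideanSpace ℝ d) 1)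
    (hρJ : ∀ w : Config N d (UnitAddTorus d), ρ (pairReflect i j (ω : EuclideanSpace ℝ d) w) = ρ w)
    (z : Config N d (UnitAddTorus d)) :
    ENNReal.ofReal (ε ^ (Fintype.card d - 1) * ⟪((ω : EuclideanSpace ℝ d)), (z i).2 - (z j).2⟫_ℝ) *
        (hardSphereDomain (Torus.geometry d) N ε).indicator
          (fun w => ρ w * F (pairReflect i j (ε⁻¹ • (Torus.geometry d).sepVec (w i).1 (w j).1) w))
          (contactInsert ε i j (ω : EuclideanSpace ℝ d) z) =
      ENNReal.ofReal (ε ^ (Fintype.card d - 1) * ⟪-(ω : EuclideanSpace ℝ d),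
          (pairReflect i j (ω : EuclideanSpace ℝ d) z i).2 - (pairReflect i j (ω : EuclideanSpace ℝ d) z j).2⟫_ℝ) *
        (hardSphereDomain (Torus.geometry d) N ε).indicator (fun w => ρ w * F w)
          (contactInsert ε i j (-(ω : EuclideanSpace ℝ d)) (pairReflect i j (ω : EuclideanSpace ℝ d) z)) := by
  have hω1 : ‖(ω : EuclideanSpace ℝ d)‖ = 1 := norm_eq_of_mem_sphere ω
  have hω0 : (ω : EuclideanSpace ℝ d) ≠ 0 := by
    intro h
    rw [h, norm_zero] at hω1
    exact zero_ne_one hω1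
  rw [inner_neg_pairReflect_vel_sub hij hω0 z, ← pairReflect_contactInsert hij ε (ω : EuclideanSpace ℝ d) z]
  congr 1
  by_cases hmem : contactInsert ε i j (ω : EuclideanSpace ℝ d) z ∈ hardSphereDomain (Torus.geometry d) N ε
  · rw [indicator_of_mem hmem,
      indicator_of_mem ((pairReflect_mem_hardSphereDomain_iff i j (ω : EuclideanSpace ℝ d) ε _).2 hmem), hρJ,
      sepVec_contactInsert hε0.le hε hij hω1.le z, smul_smul, inv_mul_cancel₀ hε0.ne', one_smul]
  · rw [indicator_of_notMem hmem,
      indicator_of_notMem (mt (pairReflect_mem_hardSphereDomain_iff i j (ω : EuclideanSpace ℝ d) ε _).1 hmem)]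

/-! ### The change of variables -/

/-- **`∫ dz ∫ dω G(pairReflect i j ω z, −ω) = ∫ dz ∫ dω G(z, ω)`** for `i ≠ j` and every jointly measurable
`G ≥ 0` on (configuration, direction): the map `(z, ω) ↦ (pairReflect i j ω z, −ω)` preserves
`volume ⊗ volume.toSphere` (Tonelli; `lintegral_comp_pairReflect` for each fixed direction; Tonelli; the antipodal map
preserves the surface measure, `measurePreserving_neg_sphere`).
[cite: CIP1994, §3.1 (the collision transformation J is a measure-preserving involution)] -/
theorem lintegral_lintegral_comp_pairReflect_neg {i j : Fin N} (hij : i ≠ j)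
    {G : Config N d (UnitAddTorus d) → EuclideanSpace ℝ d → ℝ≥0∞} (hG : Measurable (Function.uncurry G)) :
    ∫⁻ z : Config N d (UnitAddTorus d), ∫⁻ ω : Metric.sphere (0 : EuclideanSpace ℝ d) 1,
        G (pairReflect i j (ω : EuclideanSpace ℝ d) z) (-(ω : EuclideanSpace ℝ d))
        ∂(volume : Measure (EuclideanSpace ℝ d)).toSphere =
      ∫⁻ z : Config N d (UnitAddTorus d), ∫⁻ ω : Metric.sphere (0 : EuclideanSpace ℝ d) 1,
        G z (ω : EuclideanSpace ℝ d) ∂(volume : Measure (EuclideanSpace ℝ d)).toSphere := by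
  haveI hXE : SigmaFinite (volume : Measure (UnitAddTorus d × EuclideanSpace ℝ d)) := inferInstance
  haveI hC : SigmaFinite (volume : Measure (Config N d (UnitAddTorus d))) := inferInstance
  have hωm : Measurable fun p : Config N d (UnitAddTorus d) × Metric.sphere (0 : EuclideanSpace ℝ d) 1 =>
      (p.2 : EuclideanSpace ℝ d) := measurable_subtype_coe.comp measurable_snd
  have hPRm : Measurable fun p : Config N d (UnitAddTorus d) × Metric.sphere (0 : EuclideanSpace ℝ d) 1 =>
      pairReflect i j (p.2 : EuclideanSpace ℝ d) p.1 :=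
    (measurable_pairReflect_uncurry i j).comp (measurable_fst.prodMk hωm)
  have hA : AEMeasurable (Function.uncurry fun (z : Config N d (UnitAddTorus d))
      (ω : Metric.sphere (0 : EuclideanSpace ℝ d) 1) =>
        G (pairReflect i j (ω : EuclideanSpace ℝ d) z) (-(ω : EuclideanSpace ℝ d)))
      ((volume : Measure (Config N d (UnitAddTorus d))).prod
        (volume : Measure (EuclideanSpace ℝ d)).toSphere) :=
    (hG.comp (hPRm.prodMk hωm.neg)).aemeasurable
  have hB : AEMeasurable (Function.uncurry fun (z : Config N d (UnitAddTorus d))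
      (ω : Metric.sphere (0 : EuclideanSpace ℝ d) 1) => G z (-(ω : EuclideanSpace ℝ d)))
      ((volume : Measure (Config N d (UnitAddTorus d))).prod
        (volume : Measure (EuclideanSpace ℝ d)).toSphere) :=
    (hG.comp (measurable_fst.prodMk hωm.neg)).aemeasurable
  have hneg : MeasurePreserving (fun ω : Metric.sphere (0 : EuclideanSpace ℝ d) 1 => -ω)
      (volume : Measure (EuclideanSpace ℝ d)).toSphere (volume : Measure (EuclideanSpace ℝ d)).toSphere :=
    measurePreserving_neg_sphere (E := EuclideanSpace ℝ d)
  have hemb := (Homeomorph.neg (Metric.sphere (0 : EuclideanSpace ℝ d) 1)).measurableEmbedding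
  calc ∫⁻ z : Config N d (UnitAddTorus d), ∫⁻ ω : Metric.sphere (0 : EuclideanSpace ℝ d) 1,
        G (pairReflect i j (ω : EuclideanSpace ℝ d) z) (-(ω : EuclideanSpace ℝ d))
        ∂(volume : Measure (EuclideanSpace ℝ d)).toSphere
      = ∫⁻ ω : Metric.sphere (0 : EuclideanSpace ℝ d) 1, (∫⁻ z : Config N d (UnitAddTorus d),
          G (pairReflect i j (ω : EuclideanSpace ℝ d) z) (-(ω : EuclideanSpace ℝ d)))
          ∂(volume : Measure (EuclideanSpace ℝ d)).toSphere := lintegral_lintegral_swap hA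
    _ = ∫⁻ ω : Metric.sphere (0 : EuclideanSpace ℝ d) 1, (∫⁻ z : Config N d (UnitAddTorus d),
          G z (-(ω : EuclideanSpace ℝ d))) ∂(volume : Measure (EuclideanSpace ℝ d)).toSphere := by
        refine lintegral_congr fun ω => ?_
        have hf : Measurable fun z : Config N d (UnitAddTorus d) => G z (-(ω : EuclideanSpace ℝ d)) :=
          hG.of_uncurry_right
        exact lintegral_comp_pairReflect hij (ω : EuclideanSpace ℝ d) hf
    _ = ∫⁻ z : Config N d (UnitAddTorus d), ∫⁻ ω : Metric.sphere (0 : EuclideanSpace ℝ d) 1,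
          G z (-(ω : EuclideanSpace ℝ d)) ∂(volume : Measure (EuclideanSpace ℝ d)).toSphere :=
        (lintegral_lintegral_swap hB).symm
    _ = ∫⁻ z : Config N d (UnitAddTorus d), ∫⁻ ω : Metric.sphere (0 : EuclideanSpace ℝ d) 1,
          G z (ω : EuclideanSpace ℝ d) ∂(volume : Measure (EuclideanSpace ℝ d)).toSphere := by
        refine lintegral_congr fun z => ?_
        have h := hneg.lintegral_comp_emb hemb (fun ω : Metric.sphere (0 : EuclideanSpace ℝ d) 1 =>
          G z (ω : EuclideanSpace ℝ d))
        simpa only [coe_neg_sphere] using h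

/-- **The one-pair outgoing flux of `ρ · (F ∘ J*)` equals that of `ρ · F`** for `0 < ε < 1/2`, `i ≠ j`, measurable
`ρ, F ≥ 0` with `ρ` invariant under every `pairReflect i j ω` (e.g. the homogeneous Gibbs density): the integrand of
the left side at `(z, ω)` is the integrand of the right side at `(pairReflect i j ω z, −ω)`
(`fluxIntegrand_comp_pairReflect`), and `(z, ω) ↦ (pairReflect i j ω z, −ω)` preserves `volume ⊗ volume.toSphere`
(`lintegral_lintegral_comp_pairReflect_neg`). [cite: CIP1994, §4.2, App. 4.A pp. 107–111] -/
theorem pairFlux_pairReflect {ε : ℝ} (hε0 : 0 < ε) (hε : ε < 1 / 2) {i j : Fin N} (hij : i ≠ j)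
    {ρ F : Config N d (UnitAddTorus d) → ℝ≥0∞} (hρ : Measurable ρ) (hF : Measurable F)
    (hρJ : ∀ (ω : EuclideanSpace ℝ d) (w : Config N d (UnitAddTorus d)), ρ (pairReflect i j ω w) = ρ w) :
    ∫⁻ z : Config N d (UnitAddTorus d), ∫⁻ ω : Metric.sphere (0 : EuclideanSpace ℝ d) 1,
        ENNReal.ofReal (ε ^ (Fintype.card d - 1) * ⟪((ω : EuclideanSpace ℝ d)), (z i).2 - (z j).2⟫_ℝ) *
          (hardSphereDomain (Torus.geometry d) N ε).indicator
            (fun w => ρ w * F (pairReflect i j (ε⁻¹ • (Torus.geometry d).sepVec (w i).1 (w j).1) w))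
            (contactInsert ε i j (ω : EuclideanSpace ℝ d) z)
        ∂(volume : Measure (EuclideanSpace ℝ d)).toSphere =
      ∫⁻ z : Config N d (UnitAddTorus d), ∫⁻ ω : Metric.sphere (0 : EuclideanSpace ℝ d) 1,
        ENNReal.ofReal (ε ^ (Fintype.card d - 1) * ⟪((ω : EuclideanSpace ℝ d)), (z i).2 - (z j).2⟫_ℝ) *
          (hardSphereDomain (Torus.geometry d) N ε).indicator (fun w => ρ w * F w)
            (contactInsert ε i j (ω : EuclideanSpace ℝ d) z)
        ∂(volume : Measure (EuclideanSpace ℝ d)).toSphere := by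
  refine Eq.trans (lintegral_congr fun z => lintegral_congr fun ω =>
    fluxIntegrand_comp_pairReflect hε0 hε hij ω (hρJ (ω : EuclideanSpace ℝ d)) z) ?_
  exact lintegral_lintegral_comp_pairReflect_neg hij
    (G := fun (z : Config N d (UnitAddTorus d)) (ω : EuclideanSpace ℝ d) =>
      ENNReal.ofReal (ε ^ (Fintype.card d - 1) * ⟪ω, (z i).2 - (z j).2⟫_ℝ) *
        (hardSphereDomain (Torus.geometry d) N ε).indicator (fun w => ρ w * F w) (contactInsert ε i j ω z))
    (measurable_fluxIntegrand_uncurry ε i j (hρ.mul hF))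

end Tools

/-! ### The homogeneous Gibbs density is `J*`-invariant -/

/-- **The homogeneous Gibbs density is invariant under the pair reflection** (`i ≠ j`): the hard core is invariant
(`pairReflect_mem_hardSphereDomain_iff`) and the weight `∏_k a M_{1,u,θ}(v_k)` is a function of
`∑_k ‖v_k − u‖² = 2E − 2⟪P, u⟫ + n‖u‖²`, with `E` and `P` invariant (`configEnergy_pairReflect`,
`configMomentum_pairReflect`). [folklore] -/
theorem canonicalDensity_pairReflect_const (a θ : ℝ) (u : V3) (ε : ℝ) {n : ℕ} {i j : Fin n} (hij : i ≠ j)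
    (ω : V3) (w : Config n (Fin 3) T3) :
    canonicalDensity (Torus.geometry (Fin 3)) ε n (localGibbsProfile (fun _ => a) (fun _ => u) (fun _ => θ))
        (pairReflect i j ω w) =
      canonicalDensity (Torus.geometry (Fin 3)) ε n (localGibbsProfile (fun _ => a) (fun _ => u) (fun _ => θ)) w := by
  have hD := pairReflect_mem_hardSphereDomain_iff i j ω ε w
  have hT : tensorPow n (localGibbsProfile (fun _ => a) (fun _ => u) (fun _ => θ)) (pairReflect i j ω w) =
      tensorPow n (localGibbsProfile (fun _ => a) (fun _ => u) (fun _ => θ)) w := by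
    rw [tensorPow_localGibbsProfile_const a θ u, tensorPow_localGibbsProfile_const a θ u, sum_norm_vel_sub_sq_eq,
      sum_norm_vel_sub_sq_eq, configEnergy_pairReflect hij, configMomentum_pairReflect hij]
  unfold canonicalDensity
  by_cases hw : w ∈ hardSphereDomain (Torus.geometry (Fin 3)) n ε
  · rw [indicator_of_mem hw, indicator_of_mem (hD.2 hw), hT]
  · rw [indicator_of_notMem hw, indicator_of_notMem (mt hD.1 hw)]

/-! ### The stub -/

/-- **P3 `stub_fluxPairReflect` — invariance of the Gibbs-weighted outgoing contact flux under the pair reflection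
`J*`** (line `KineticSlabSketch`, crux `JParityClosure.OddContactSymmetry`).  For the canonical Gibbs density `ρ_G`
of constant profiles `(a, u, θ)` and every measurable mark `F ≥ 0`:
`outgoingCollisionFlux ε (N+1) (ρ_G · (F ∘ J*)) = outgoingCollisionFlux ε (N+1) (ρ_G · F)`, `ε = hsDiameter σ N`,
where inside the flux integrand `J* = pairReflect i j (ε⁻¹ sepVec x_i x_j)` is read on the contact configuration.
Pair by pair this is `pairFlux_pairReflect` with the `J*`-invariant weight `ρ_G`
(`canonicalDensity_pairReflect_const`); `0 < ε ≤ σ < 1/2` by `hsDiameter_pos`, `hsDiameter_le`.  The hypothesis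
`0 < θ` is not needed. [cite: CIP1994, §4.2, App. 4.A pp. 107–111] -/
theorem stub_fluxPairReflect :
    ∀ {σ : ℝ} (_hσ : 0 < σ) (_hσ2 : σ < 1 / 2) {θ : ℝ} (_hθ : 0 < θ) (a : ℝ) (u : V3) (N : ℕ)
    {F : Config (N + 1) (Fin 3) T3 → Fin (N + 1) → Fin (N + 1) → ℝ≥0∞} (_hF : ∀ i j, Measurable fun w => F w i j),
    outgoingCollisionFlux (hsDiameter σ N) (N + 1)
        (fun w i j => ENNReal.ofReal (canonicalDensity (Torus.geometry (Fin 3)) (hsDiameter σ N) (N + 1)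
          (localGibbsProfile (fun _ => a) (fun _ => u) (fun _ => θ)) w) *
          F (pairReflect i j ((hsDiameter σ N)⁻¹ • (Torus.geometry (Fin 3)).sepVec (w i).1 (w j).1) w) i j) =
      outgoingCollisionFlux (hsDiameter σ N) (N + 1)
        (fun w i j => ENNReal.ofReal (canonicalDensity (Torus.geometry (Fin 3)) (hsDiameter σ N) (N + 1)
          (localGibbsProfile (fun _ => a) (fun _ => u) (fun _ => θ)) w) * F w i j) := by
  intro σ hσ hσ2 θ _hθ a u N F hF
  have hε0 : 0 < hsDiameter σ N := hsDiameter_pos hσ N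
  have hε : hsDiameter σ N < 1 / 2 := (hsDiameter_le hσ.le N).trans_lt hσ2
  have hρ : Measurable fun w : Config (N + 1) (Fin 3) T3 =>
      ENNReal.ofReal (canonicalDensity (Torus.geometry (Fin 3)) (hsDiameter σ N) (N + 1)
        (localGibbsProfile (fun _ => a) (fun _ => u) (fun _ => θ)) w) :=
    (measurable_canonicalDensity _ _
      (measurable_localGibbsProfile continuous_const continuous_const continuous_const)).ennreal_ofReal
  unfold outgoingCollisionFlux
  refine Finset.sum_congr rfl fun i _ => Finset.sum_congr rfl fun j _ => ?_
  by_cases hij : i = j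
  · simp only [if_pos hij]
  · simp only [if_neg hij]
    exact pairFlux_pairReflect hε0 hε hij hρ (hF i j) fun ω w => by
      rw [canonicalDensity_pairReflect_const a θ u (hsDiameter σ N) hij ω w]

end Summit.AtomisticToContinuum.HydrodynamicLimit.Theorems.OddContactSymmetryKineticSlabSketch

end
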